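/-
COR-CM (cell pub-hodgecm2, stage 2 of the Hodge ladder) — count-neutral KERNEL COMBINATORICS «order 16: the quaternion doublings `Q₈ × ℤ/2` and
`Q₈ ∘ ℤ/4` (Pauli)», part IIb: the CORE and the normal form (seat prover-pub-hodgecm2-b23-g54-0, binder prover b23, gen 54; claim HOME/INBOX.md
l.25095).  Bookkeeping definition with body (the core subgroup `Datum.H := closure {i, j}`) + theorems on part II BY NAME: pure group theory, no CM type,
no `decide` beyond closed identities in `ZMod 2`, no certificate, no named fact, no `sorry`.  `Interfaces.lean` (C1), every E term, B01, `Transposition/*`,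
`PortJoin/*`, `D2Bridge/*` untouched.
HONEST FRAMING: `HC_CM` is NOT proved, here or anywhere in the tree; nothing here is a period, a count of record or a headline.
T5: n/a-class (hypothesis binders = the fields of `QuaternionDoubling.Datum`); checker: self.
-/
import Summits.HodgeConjecture.CorCM.Census.QuaternionDoublingDatum

/-!
# The quaternion doublings, IIb: the core `H = ⟨i, j⟩ ≅ Q₈` and the normal form `iᵘ jᵛ xᵈ`

Along a quaternion doubling datum `D : Datum G c τ`:
* §3 **the core** `H = closure {i, j} = {iᵘ jᵛ : u < 4, v < 2}` (`mem_H_iff`), `|H| = 8`, `[G : H] = 2`, `c ∈ H`, `x ∉ H`, and inside `H`: `i` has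
  order `4`, `⟨i⟩` has index two, `j ∉ ⟨i⟩`, `j i j⁻¹ = i⁻¹`, `i² = j² = c` (the hypotheses of seat b23 gen 50ʼs
  `IndexTwoCyclic.isLeast_card_gfaces_generate_fibreTwo_of_quaternion` for the subgroup `H`);
* §4 **exhaustion**: every element is uniquely `iᵘ jᵛ xᵈ` (`u < 4`, `v, d < 2`); `c` is central (`c_mem_center`); elements outside `H` are `h·x`.
All [folklore].

## References
* [Pohlmann1968] H. Pohlmann, Algebraic cycles on abelian varieties of complex multiplication type, Ann. of Math. 88 (1968), Thm 1.
-/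

namespace Summit.HodgeConjecture.CorCM.Census.QuaternionDoubling

open Finset

noncomputable section

variable {G : Type*} [Group G] [Fintype G] [DecidableEq G] {c : G} {τ : ZMod 2} (D : Datum G c τ)

namespace Datum

include D

/-! ## §3 The core `H = ⟨i, j⟩ ≅ Q₈` -/

/-- **The core**: the subgroup generated by `i` and `j`. [folklore] -/
def H : Subgroup G := Subgroup.closure {D.i, D.j}

omit [Fintype G] [DecidableEq G] in
/-- `i ∈ H`. [folklore] -/
theorem i_mem_H : D.i ∈ D.H := Subgroup.subset_closure (Set.mem_insert _ _)

omit [Fintype G] [DecidableEq G] in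
/-- `j ∈ H`. [folklore] -/
theorem j_mem_H : D.j ∈ D.H := Subgroup.subset_closure (Set.mem_insert_of_mem _ rfl)

omit [Fintype G] [DecidableEq G] in
/-- The words `iᵘ jᵛ` lie in `H`. [folklore] -/
theorem word_mem_H (u v : ℕ) : D.i ^ u * D.j ^ v ∈ D.H := mul_mem (D.H.pow_mem D.i_mem_H u) (D.H.pow_mem D.j_mem_H v)

omit [Fintype G] [DecidableEq G] in
/-- `c ∈ H`. [folklore] -/
theorem c_mem_H : c ∈ D.H := by
  have h : D.i * D.i ∈ D.H := mul_mem D.i_mem_H D.i_mem_H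
  rwa [D.hii] at h

omit [Fintype G] [DecidableEq G] in
/-- `iᵘ j = j i^{3u}` (`j` inverts `i`, `i⁻¹ = i³`). [folklore] -/
theorem i_pow_mul_j (u : ℕ) : D.i ^ u * D.j = D.j * D.i ^ (3 * u) := by
  have h3 : D.i ^ 3 = D.i⁻¹ := by rw [D.i_inv, pow_succ, pow_two, D.hii]
  have h0 : D.j * (D.i⁻¹ * D.j⁻¹) = D.i := by
    have := congrArg (·⁻¹) D.hji
    simpa only [mul_inv_rev, inv_inv] using this
  have h1 : D.i * D.j = D.j * D.i ^ 3 := by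
    calc D.i * D.j = D.j * (D.i⁻¹ * D.j⁻¹) * D.j := by rw [h0]
      _ = D.j * D.i⁻¹ := by group
      _ = D.j * D.i ^ 3 := by rw [h3]
  induction u with
  | zero => simp
  | succ u ih =>
    calc D.i ^ (u + 1) * D.j = D.i ^ u * (D.i * D.j) := by rw [pow_succ]; group
      _ = D.i ^ u * D.j * D.i ^ 3 := by rw [h1]; group
      _ = D.j * D.i ^ (3 * u) * D.i ^ 3 := by rw [ih]
      _ = D.j * D.i ^ (3 * (u + 1)) := by rw [mul_assoc, ← pow_add, show 3 * u + 3 = 3 * (u + 1) by ring]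

omit [Fintype G] [DecidableEq G] in
/-- Reduction of exponents of `i` modulo `4`. [folklore] -/
theorem i_pow_mod (u : ℕ) : D.i ^ u = D.i ^ (u % 4) := by
  conv_lhs => rw [← Nat.mod_add_div u 4, pow_add, pow_mul, D.i_pow_four, one_pow, mul_one]

omit [Fintype G] [DecidableEq G] in
/-- The word set `{iᵘ jᵛ : u < 4, v < 2}` is closed under right multiplication by `i`, `j`, `i⁻¹`, `j⁻¹`. [folklore] -/
theorem word_mul_gen {u v : ℕ} (hv : v < 2) (g : G) (hg : g = D.i ∨ g = D.j ∨ g = D.i⁻¹ ∨ g = D.j⁻¹) :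
    ∃ u' : ℕ, u' < 4 ∧ ∃ v' : ℕ, v' < 2 ∧ D.i ^ u * D.j ^ v * g = D.i ^ u' * D.j ^ v' := by
  -- first `· i` and `· j`, then the inverses as `c·i = i³`, `c·j`
  have hi : ∀ u v : ℕ, v < 2 → ∃ u' : ℕ, u' < 4 ∧ ∃ v' : ℕ, v' < 2 ∧ D.i ^ u * D.j ^ v * D.i = D.i ^ u' * D.j ^ v' := by
    intro u v hv
    interval_cases v
    · refine ⟨(u + 1) % 4, Nat.mod_lt _ (by norm_num), 0, by norm_num, ?_⟩
      simp only [pow_zero, mul_one]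
      rw [← pow_succ, ← D.i_pow_mod]
    · refine ⟨(u + 3) % 4, Nat.mod_lt _ (by norm_num), 1, by norm_num, ?_⟩
      have hji1 : D.j * D.i = D.i ^ 3 * D.j := by
        have h := D.i_pow_mul_j 3
        rw [show 3 * 3 = 4 * 2 + 1 by norm_num, pow_add, pow_mul, D.i_pow_four, one_pow, one_mul, pow_one] at h
        exact h.symm
      simp only [pow_one]
      rw [mul_assoc, hji1, ← mul_assoc, ← pow_add, ← D.i_pow_mod]
  have hj : ∀ u v : ℕ, v < 2 → ∃ u' : ℕ, u' < 4 ∧ ∃ v' : ℕ, v' < 2 ∧ D.i ^ u * D.j ^ v * D.j = D.i ^ u' * D.j ^ v' := by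
    intro u v hv
    interval_cases v
    · refine ⟨u % 4, Nat.mod_lt _ (by norm_num), 1, by norm_num, ?_⟩
      simp only [pow_zero, mul_one, pow_one]
      rw [← D.i_pow_mod]
    · refine ⟨(u + 2) % 4, Nat.mod_lt _ (by norm_num), 0, by norm_num, ?_⟩
      simp only [pow_one, pow_zero, mul_one]
      rw [mul_assoc, D.hjj, ← D.i_pow_mod, pow_add, pow_two, D.hii]
  rcases hg with rfl | rfl | rfl | rfl
  · exact hi u v hv
  · exact hj u v hv
  · -- `i⁻¹ = i³`
    rw [show D.i⁻¹ = D.i * D.i * D.i by rw [D.i_inv, D.hii]]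
    obtain ⟨u₁, hu₁, v₁, hv₁, h₁⟩ := hi u v hv
    obtain ⟨u₂, hu₂, v₂, hv₂, h₂⟩ := hi u₁ v₁ hv₁
    obtain ⟨u₃, hu₃, v₃, hv₃, h₃⟩ := hi u₂ v₂ hv₂
    exact ⟨u₃, hu₃, v₃, hv₃, by rw [← mul_assoc, ← mul_assoc, h₁, h₂, h₃]⟩
  · -- `j⁻¹ = j³`
    rw [show D.j⁻¹ = D.j * D.j * D.j by rw [D.j_inv, D.hjj]]
    obtain ⟨u₁, hu₁, v₁, hv₁, h₁⟩ := hj u v hv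
    obtain ⟨u₂, hu₂, v₂, hv₂, h₂⟩ := hj u₁ v₁ hv₁
    obtain ⟨u₃, hu₃, v₃, hv₃, h₃⟩ := hj u₂ v₂ hv₂
    exact ⟨u₃, hu₃, v₃, hv₃, by rw [← mul_assoc, ← mul_assoc, h₁, h₂, h₃]⟩

omit [Fintype G] [DecidableEq G] in
/-- **`H = {iᵘ jᵛ : u < 4, v < 2}`.** [folklore] -/
theorem mem_H_iff (g : G) : g ∈ D.H ↔ ∃ u : ℕ, u < 4 ∧ ∃ v : ℕ, v < 2 ∧ g = D.i ^ u * D.j ^ v := by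
  constructor
  · intro hg
    refine Subgroup.closure_induction_right (p := fun g _ => ∃ u : ℕ, u < 4 ∧ ∃ v : ℕ, v < 2 ∧ g = D.i ^ u * D.j ^ v)
      ⟨0, by norm_num, 0, by norm_num, by simp⟩ ?_ ?_ hg
    · rintro g - y hy ⟨u, hu, v, hv, rfl⟩
      have hy' : y = D.i ∨ y = D.j ∨ y = D.i⁻¹ ∨ y = D.j⁻¹ := by
        rcases hy with rfl | hy
        · exact Or.inl rfl
        · exact Or.inr (Or.inl (Set.mem_singleton_iff.mp hy))
      exact D.word_mul_gen hv y hy'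
    · rintro g - y hy ⟨u, hu, v, hv, rfl⟩
      have hy' : y⁻¹ = D.i ∨ y⁻¹ = D.j ∨ y⁻¹ = D.i⁻¹ ∨ y⁻¹ = D.j⁻¹ := by
        rcases hy with rfl | hy
        · exact Or.inr (Or.inr (Or.inl rfl))
        · exact Or.inr (Or.inr (Or.inr (by rw [Set.mem_singleton_iff.mp hy])))
      exact D.word_mul_gen hv y⁻¹ hy'
  · rintro ⟨u, -, v, -, rfl⟩
    exact D.word_mem_H u v

omit [Fintype G] [DecidableEq G] in
/-- **The words `iᵘ jᵛ` (`u < 4`, `v < 2`) are distinct.** [folklore] -/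
private theorem word_inj {u v u' v' : ℕ} (hu : u < 4) (hu' : u' < 4) (hv : v < 2) (hv' : v' < 2)
    (h : D.i ^ u * D.j ^ v = D.i ^ u' * D.j ^ v') : u = u' ∧ v = v' := by
  have hvv : v = v' := by
    by_contra hne
    have key : ∀ {a b : ℕ}, D.i ^ a * D.j = D.i ^ b → False := fun {a b} hab =>
      D.hj (by
        have : D.j = (D.i ^ a)⁻¹ * D.i ^ b := by rw [← hab, inv_mul_cancel_left]
        rw [this]
        exact mul_mem (inv_mem (Subgroup.pow_mem _ (Subgroup.mem_zpowers _) _)) (Subgroup.pow_mem _ (Subgroup.mem_zpowers _) _))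
    interval_cases v <;> interval_cases v'
    · exact hne rfl
    · rw [pow_zero, mul_one, pow_one] at h; exact key h.symm
    · rw [pow_zero, mul_one, pow_one] at h; exact key h
    · exact hne rfl
  subst hvv
  refine ⟨?_, rfl⟩
  have h' : D.i ^ u = D.i ^ u' := mul_right_cancel h
  have := pow_inj_mod.mp h'
  rwa [D.hord_i, Nat.mod_eq_of_lt hu, Nat.mod_eq_of_lt hu'] at this

omit [Fintype G] [DecidableEq G] in
/-- **`|H| = 8`.** [folklore] -/
theorem card_H : Nat.card D.H = 8 := by
  classical
  let f : Fin 4 × Fin 2 → D.H := fun t => ⟨D.i ^ (t.1 : ℕ) * D.j ^ (t.2 : ℕ), D.word_mem_H _ _⟩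
  have hinj : Function.Injective f := by
    rintro ⟨u, v⟩ ⟨u', v'⟩ h
    obtain ⟨h1, h2⟩ := D.word_inj u.2 u'.2 v.2 v'.2 (congrArg Subtype.val h)
    ext <;> simp only [h1, h2]
  have hsurj : Function.Surjective f := by
    rintro ⟨g, hg⟩
    obtain ⟨u, hu, v, hv, rfl⟩ := (D.mem_H_iff g).mp hg
    exact ⟨(⟨u, hu⟩, ⟨v, hv⟩), rfl⟩
  rw [← Nat.card_eq_of_bijective f ⟨hinj, hsurj⟩]
  simp

omit [Fintype G] [DecidableEq G] in
/-- **`x ∉ H`.** [folklore] -/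
theorem x_notMem_H : D.x ∉ D.H := fun h => by
  obtain ⟨u, -, v, -, huv⟩ := (D.mem_H_iff D.x).mp h
  exact D.hx u v huv

omit [DecidableEq G] in
/-- **`|G| = 16`** as a `Fintype.card`. [folklore] -/
theorem card_eq : Fintype.card G = 16 := by rw [← Nat.card_eq_fintype_card, D.hcard]

omit [Fintype G] [DecidableEq G] in
/-- **`[G : H] = 2`.** [folklore] -/
theorem index_H : D.H.index = 2 := by
  have h := D.H.card_mul_index
  rw [D.card_H, D.hcard] at h
  omega

omit [Fintype G] [DecidableEq G] in
/-- Inside the core: `i` (as an element of `H`) has order `4`. [folklore] -/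
theorem orderOf_i_H : orderOf (⟨D.i, D.i_mem_H⟩ : D.H) = 4 := by rw [Subgroup.orderOf_mk, D.hord_i]

omit [Fintype G] [DecidableEq G] in
/-- Inside the core: `j ∉ ⟨i⟩`. [folklore] -/
theorem j_notMem_zpowers_i_H : (⟨D.j, D.j_mem_H⟩ : D.H) ∉ Subgroup.zpowers (⟨D.i, D.i_mem_H⟩ : D.H) := by
  intro h
  apply D.hj
  obtain ⟨k, hk⟩ := Subgroup.mem_zpowers_iff.mp h
  have := congrArg Subtype.val hk
  simp only [SubgroupClass.coe_zpow] at this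
  exact Subgroup.mem_zpowers_iff.mpr ⟨k, this⟩

omit [Fintype G] [DecidableEq G] in
/-- Inside the core: `⟨i⟩` has index two. [folklore] -/
theorem index_zpowers_i_H : (Subgroup.zpowers (⟨D.i, D.i_mem_H⟩ : D.H)).index = 2 := by
  have h := (Subgroup.zpowers (⟨D.i, D.i_mem_H⟩ : D.H)).card_mul_index
  rw [Nat.card_zpowers, D.orderOf_i_H, D.card_H] at h
  omega

omit [Fintype G] [DecidableEq G] in
/-- Inside the core: `j i j⁻¹ = i⁻¹`. [folklore] -/
theorem hji_H : (⟨D.j, D.j_mem_H⟩ : D.H) * ⟨D.i, D.i_mem_H⟩ * (⟨D.j, D.j_mem_H⟩ : D.H)⁻¹ = (⟨D.i, D.i_mem_H⟩ : D.H)⁻¹ :=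
  Subtype.ext D.hji

omit [Fintype G] [DecidableEq G] in
/-- Inside the core: `i² = c` and `j² = c`. [folklore] -/
theorem sq_H : (⟨D.i, D.i_mem_H⟩ : D.H) ^ 2 = ⟨c, D.c_mem_H⟩ ∧ (⟨D.j, D.j_mem_H⟩ : D.H) * ⟨D.j, D.j_mem_H⟩ = ⟨c, D.c_mem_H⟩ :=
  ⟨Subtype.ext (by rw [pow_two]; exact D.hii), Subtype.ext D.hjj⟩

/-! ## §4 The normal form `iᵘ jᵛ xᵈ` -/

omit [Fintype G] [DecidableEq G] in
/-- **The normal form is injective**: the elements `iᵘ jᵛ xᵈ` (`u < 4`, `v < 2`, `d < 2`) are pairwise distinct. [folklore] -/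
theorem normalForm_inj {u v d u' v' d' : ℕ} (hu : u < 4) (hu' : u' < 4) (hv : v < 2) (hv' : v' < 2) (hd : d < 2) (hd' : d' < 2)
    (h : D.i ^ u * D.j ^ v * D.x ^ d = D.i ^ u' * D.j ^ v' * D.x ^ d') : u = u' ∧ v = v' ∧ d = d' := by
  have hmem : D.x ^ d * (D.x ^ d')⁻¹ ∈ D.H := by
    have : D.x ^ d * (D.x ^ d')⁻¹ = (D.i ^ u * D.j ^ v)⁻¹ * (D.i ^ u' * D.j ^ v') := by
      rw [mul_inv_eq_iff_eq_mul, mul_assoc, ← h, inv_mul_cancel_left]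
    rw [this]
    exact mul_mem (inv_mem (D.word_mem_H u v)) (D.word_mem_H u' v')
  have hdd : d = d' := by
    by_contra hne
    interval_cases d <;> interval_cases d'
    · exact hne rfl
    · rw [pow_zero, one_mul, pow_one, D.x_inv] at hmem; exact D.x_notMem_H hmem
    · rw [pow_one, pow_zero, inv_one, mul_one] at hmem; exact D.x_notMem_H hmem
    · exact hne rfl
  subst hdd
  obtain ⟨h1, h2⟩ := D.word_inj hu hu' hv hv' (mul_right_cancel h)
  exact ⟨h1, h2, rfl⟩

omit [DecidableEq G] in
/-- **EXHAUSTION: every element is `iᵘ jᵛ xᵈ`** with `u < 4`, `v < 2`, `d < 2` (the `16` normal forms are distinct in a group of order `16`).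
[folklore] -/
theorem exhaust (y : G) : ∃ u : ℕ, u < 4 ∧ ∃ v : ℕ, v < 2 ∧ ∃ d : ℕ, d < 2 ∧ y = D.i ^ u * D.j ^ v * D.x ^ d := by
  classical
  let f : Fin 4 × Fin 2 × Fin 2 → G := fun t => D.i ^ (t.1 : ℕ) * D.j ^ (t.2.1 : ℕ) * D.x ^ (t.2.2 : ℕ)
  have hinj : Function.Injective f := by
    rintro ⟨u, v, d⟩ ⟨u', v', d'⟩ h
    obtain ⟨h1, h2, h3⟩ := D.normalForm_inj u.2 u'.2 v.2 v'.2 d.2 d'.2 h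
    ext <;> simp only [h1, h2, h3]
  have hcard : Fintype.card (Fin 4 × Fin 2 × Fin 2) = Fintype.card G := by rw [D.card_eq]; simp
  have hbij : Function.Bijective f := (Fintype.bijective_iff_injective_and_card f).mpr ⟨hinj, hcard⟩
  obtain ⟨⟨u, v, d⟩, rfl⟩ := hbij.2 y
  exact ⟨u, u.2, v, v.2, d, d.2, rfl⟩

omit [DecidableEq G] in
/-- **`c` is central.** [folklore] -/
theorem c_mem_center : c ∈ Subgroup.center G := by
  refine Subgroup.mem_center_iff.mpr fun y => ?_
  obtain ⟨u, -, v, -, d, -, rfl⟩ := D.exhaust y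
  exact (((D.commute_i_c.pow_left u).mul_left (D.commute_j_c.pow_left v)).mul_left (D.commute_x_c.pow_left d)).eq

omit [DecidableEq G] in
/-- Every element outside `H` is `h·x` with `h ∈ H`. [folklore] -/
theorem exists_eq_mul_x_of_notMem {y : G} (hy : y ∉ D.H) : ∃ h ∈ D.H, y = h * D.x := by
  obtain ⟨u, -, v, -, d, hd, rfl⟩ := D.exhaust y
  interval_cases d
  · exact absurd (by rw [pow_zero, mul_one]; exact D.word_mem_H u v) hy
  · exact ⟨D.i ^ u * D.j ^ v, D.word_mem_H u v, by rw [pow_one]⟩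

end Datum

end

end Summit.HodgeConjecture.CorCM.Census.QuaternionDoubling
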